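import Literature.Analysis.FluidPDE.PressureRepresentation
import Literature.Analysis.FluidPDE.HarmonicBallMeanValue
import Literature.Analysis.FluidPDE.CommutatorCZTransfer
import Literature.Analysis.FluidPDE.TaoY6KernelNorms
import HarnessLib

/-!
# Route `SqueezeCycle`, crux `ExtremalBiaxialitySubcritical` — kernel and cutoff calculus for the
# polar-quadrupole tomography of the pressure Hessian (line `oseen-shell-polar-tomography`,
# stub `stub_payerTomography`), I

Helper file for item `stmt-NavierStokesRegularity-11609`
(`Summit.NavierStokesRegularity.NavierStokesRegularity.Theses.SqueezeCycle.ExtremalBiaxialitySubcritical`).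
Elementary facts about the smooth near/far splitting `Γ = Γ₀ + Γ∞` of the Newtonian kernel of
`ℝ³` (`newtonNear`, `newtonFar`, `newtonFarLaplacian` of `FluidPDE/NewtonKernel`) at a variable
scale, used by the far-shell bound and the Hessian tomography of the sequel files:

* the rescaled sup bounds `‖D³Γ∞^{cr₀,cr₁}‖ ≤ c⁻⁴M₃`, `‖D⁴Γ∞^{cr₀,cr₁}‖ ≤ c⁻⁵M₄`
  (chain rule for dilations, `fderiv2_const_smul_comp_smul` of `HarmonicProbe`);
* the gradient of the radial cutoff `θ_{s,R} = radialCutoff s R`: it is radial and inward,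
  `‖Dθ(z)‖ ‖z‖ = −Dθ(z) z`, whence the boundary-free bound `∫ ‖Dθ_{s,R}‖ ≤ 3 |B̄_R| / s`
  (one integration by parts against the identity field, `div id = 3`);
* the Gilbarg–Trudinger formula for the second derivatives of the truncated Newtonian potential
  in the form `∫ Γ₀(z) ∂ₑ∂ₑG(x − z) dz = ∫ D²Γ₀(z)(e,e) (G(x − z) − G(x)) dz` for `G ∈ C²`,
  bounded and Lipschitz (a repackaging of the tree's `czDiff_newtonNearHess_eq_newtonNearPotential`).

Sources: D. Gilbarg, N. S. Trudinger, *Elliptic PDE of Second Order* (2001), Lemma 4.2 with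
(4.10) [GilbargTrudinger2001]; everything else is calculus folklore.
-/

noncomputable section

open MeasureTheory Set Filter Metric Topology InnerProductSpace Function Real
open scoped RealInnerProductSpace Laplacian ContDiff ENNReal NNReal

namespace Summit.NavierStokesRegularity.NavierStokesRegularity.Theorems

open Literature.Analysis Literature.Analysis.FluidPDE

set_option linter.dupNamespace false

-- nested operator types `ℝ³ →L[ℝ] ℝ³ →L[ℝ] ℝ³ →L[ℝ] ℝ³ →L[ℝ] ℝ`
set_option maxSynthPendingDepth 4

/-! ## Rescaled sup bounds for the far kernel and for `λ = ΔΓ∞` -/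

section FarKernel

variable {r₀ r₁ : ℝ}

/-- A uniform bound `‖D³Γ∞^{r₀,r₁}‖ ≤ M` rescales to `‖D³Γ∞^{cr₀,cr₁}‖ ≤ c⁻⁴ M`. [folklore] -/
theorem norm_fderiv3_newtonFar_scale_le {c : ℝ} (hc : 0 < c) {M : ℝ}
    (hM : ∀ w, ‖fderiv ℝ (fderiv ℝ (fderiv ℝ (newtonFar r₀ r₁))) w‖ ≤ M)
    (z : EuclideanSpace ℝ (Fin 3)) :
    ‖fderiv ℝ (fderiv ℝ (fderiv ℝ (newtonFar (c * r₀) (c * r₁)))) z‖ ≤ c⁻¹ ^ 4 * M := by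
  rw [newtonFar_scale' hc, fderiv2_const_smul_comp_smul _ _ (inv_ne_zero hc.ne'),
    fderiv_const_smul_comp_smul _ _ (inv_ne_zero hc.ne')]
  dsimp only
  rw [norm_smul, show c⁻¹ * c⁻¹ ^ 2 * c⁻¹ = c⁻¹ ^ 4 by ring, norm_pow, norm_inv,
    Real.norm_eq_abs, abs_of_pos hc]
  exact mul_le_mul_of_nonneg_left (hM _) (by positivity)

/-- A uniform bound `‖D⁴Γ∞^{r₀,r₁}‖ ≤ M` rescales to `‖D⁴Γ∞^{cr₀,cr₁}‖ ≤ c⁻⁵ M`. [folklore] -/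
theorem norm_fderiv4_newtonFar_scale_le {c : ℝ} (hc : 0 < c) {M : ℝ}
    (hM : ∀ w, ‖fderiv ℝ (fderiv ℝ (fderiv ℝ (fderiv ℝ (newtonFar r₀ r₁)))) w‖ ≤ M)
    (z : EuclideanSpace ℝ (Fin 3)) :
    ‖fderiv ℝ (fderiv ℝ (fderiv ℝ (fderiv ℝ (newtonFar (c * r₀) (c * r₁))))) z‖ ≤
      c⁻¹ ^ 5 * M := by
  rw [newtonFar_scale' hc, fderiv2_const_smul_comp_smul _ _ (inv_ne_zero hc.ne'),
    fderiv_const_smul_comp_smul _ _ (inv_ne_zero hc.ne'),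
    fderiv_const_smul_comp_smul _ _ (inv_ne_zero hc.ne')]
  dsimp only
  rw [norm_smul, show c⁻¹ * c⁻¹ ^ 2 * c⁻¹ * c⁻¹ = c⁻¹ ^ 5 by ring, norm_pow, norm_inv,
    Real.norm_eq_abs, abs_of_pos hc]
  exact mul_le_mul_of_nonneg_left (hM _) (by positivity)

/-- `Γ∞^{R/2,R}` is the `(1,2)`-kernel rescaled by `c = R/2`. [folklore] -/
theorem newtonFar_half_eq (R : ℝ) :
    newtonFar (R / 2) R = newtonFar (R / 2 * 1) (R / 2 * 2) := by
  rw [mul_one, show R / 2 * 2 = R by ring]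

/-- **Rescaled bounds for the derivatives of `Γ∞^{R/2,R}`**: `‖D²Γ∞^{R/2,R}‖ ≤ 8M₂/R³`,
`‖D³Γ∞^{R/2,R}‖ ≤ 16M₃/R⁴`, `‖D⁴Γ∞^{R/2,R}‖ ≤ 32M₄/R⁵`, where `M₂, M₃, M₄` bound the
corresponding derivatives of `Γ∞^{1,2}` (`Γ∞^{R/2,R} = (R/2)`-rescaling of `Γ∞^{1,2}`). [folklore] -/
theorem newtonFar_half_derivs_le {R : ℝ} (hR : 0 < R) {M₂ M₃ M₄ : ℝ}
    (hM₂ : ∀ w, ‖fderiv ℝ (fderiv ℝ (newtonFar (1 : ℝ) 2)) w‖ ≤ M₂)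
    (hM₃ : ∀ w, ‖fderiv ℝ (fderiv ℝ (fderiv ℝ (newtonFar (1 : ℝ) 2))) w‖ ≤ M₃)
    (hM₄ : ∀ w, ‖fderiv ℝ (fderiv ℝ (fderiv ℝ (fderiv ℝ (newtonFar (1 : ℝ) 2)))) w‖ ≤ M₄) :
    (∀ z, ‖fderiv ℝ (fderiv ℝ (newtonFar (R / 2 * 1) (R / 2 * 2))) z‖ ≤ 8 * M₂ / R ^ 3) ∧
    (∀ z, ‖fderiv ℝ (fderiv ℝ (fderiv ℝ (newtonFar (R / 2 * 1) (R / 2 * 2)))) z‖ ≤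
      16 * M₃ / R ^ 4) ∧
    (∀ z, ‖fderiv ℝ (fderiv ℝ (fderiv ℝ (fderiv ℝ (newtonFar (R / 2 * 1) (R / 2 * 2))))) z‖ ≤
      32 * M₄ / R ^ 5) := by
  have hc : 0 < R / 2 := by positivity
  have hR0 : R ≠ 0 := hR.ne'
  have e3 : (R / 2)⁻¹ ^ 3 * M₂ = 8 * M₂ / R ^ 3 := by field_simp; ring
  have e4 : (R / 2)⁻¹ ^ 4 * M₃ = 16 * M₃ / R ^ 4 := by field_simp; ring
  have e5 : (R / 2)⁻¹ ^ 5 * M₄ = 32 * M₄ / R ^ 5 := by field_simp; ring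
  exact ⟨fun z => e3 ▸ norm_fderiv2_newtonFar_scale_le hc hM₂ z,
    fun z => e4 ▸ norm_fderiv3_newtonFar_scale_le hc hM₃ z,
    fun z => e5 ▸ norm_fderiv4_newtonFar_scale_le hc hM₄ z⟩

end FarKernel

/-! ## The gradient of the radial cutoff -/

section Cutoff

variable {s R : ℝ}

/-- The profile `Θ_{s,R}` of the radial cutoff is nonincreasing for `s < R`. [folklore] -/
theorem antitone_cutoffProfile (h₁ : s < R) (hs : 0 ≤ s) : Antitone (cutoffProfile s R) := by
  have hd : 0 < R ^ 2 - s ^ 2 := by nlinarith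
  intro a b hab
  unfold cutoffProfile
  exact Real.smoothTransition.monotone (div_le_div_of_nonneg_right (by linarith) hd.le)

/-- The derivative of the radial cutoff: `Dθ_{s,R}(z) = 2Θ'(|z|²) ⟨z, ·⟩` with `Θ' ≤ 0`.
[folklore] -/
theorem fderiv_radialCutoff_eq (z : EuclideanSpace ℝ (Fin 3)) :
    fderiv ℝ (radialCutoff s R : EuclideanSpace ℝ (Fin 3) → ℝ) z =
      (2 * deriv (cutoffProfile s R) (‖z‖ ^ 2)) •
        (innerSL ℝ z : EuclideanSpace ℝ (Fin 3) →L[ℝ] ℝ) := by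
  have hd : HasDerivAt (cutoffProfile s R) (deriv (cutoffProfile s R) (‖z‖ ^ 2)) (‖z‖ ^ 2) :=
    (((cutoffProfile_contDiff s R (n := 1)).differentiable one_ne_zero) _).hasDerivAt
  exact (hasFDerivAt_comp_norm_sq (E := EuclideanSpace ℝ (Fin 3)) hd).fderiv

/-- **The cutoff gradient is radial and inward**: `‖Dθ_{s,R}(z)‖ ‖z‖ = −Dθ_{s,R}(z) z`
(`0 ≤ s < R`). [folklore] -/
theorem norm_fderiv_radialCutoff_mul_norm (hs : 0 ≤ s) (h₁ : s < R)
    (z : EuclideanSpace ℝ (Fin 3)) :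
    ‖fderiv ℝ (radialCutoff s R : EuclideanSpace ℝ (Fin 3) → ℝ) z‖ * ‖z‖ =
      -fderiv ℝ (radialCutoff s R : EuclideanSpace ℝ (Fin 3) → ℝ) z z := by
  have hθ' : deriv (cutoffProfile s R) (‖z‖ ^ 2) ≤ 0 := (antitone_cutoffProfile h₁ hs).deriv_nonpos
  rw [fderiv_radialCutoff_eq, norm_smul, innerSL_apply_norm, _root_.FunLike.coe_smul,
    Pi.smul_apply, innerSL_apply_apply, real_inner_self_eq_norm_sq, Real.norm_eq_abs,
    abs_of_nonpos (by linarith), smul_eq_mul]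
  ring

/-- `‖Dθ_{s,R}(z)‖ ≤ −Dθ_{s,R}(z) z / s` for `0 < s < R`: the gradient vanishes on `|z| < s`, and
`‖z‖ ≥ s` elsewhere. [folklore] -/
theorem norm_fderiv_radialCutoff_le (hs : 0 < s) (h₁ : s < R) (z : EuclideanSpace ℝ (Fin 3)) :
    ‖fderiv ℝ (radialCutoff s R : EuclideanSpace ℝ (Fin 3) → ℝ) z‖ ≤
      -fderiv ℝ (radialCutoff s R : EuclideanSpace ℝ (Fin 3) → ℝ) z z / s := by
  rw [← norm_fderiv_radialCutoff_mul_norm hs.le h₁ z]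
  by_cases hz : ‖z‖ < s
  · have h0 : fderiv ℝ (radialCutoff s R : EuclideanSpace ℝ (Fin 3) → ℝ) z = 0 := by
      rw [(radialCutoff_eventuallyEq_one (E := EuclideanSpace ℝ (Fin 3)) hs.le h₁ hz).fderiv_eq]
      exact fderiv_const_apply 1
    rw [h0, norm_zero, zero_mul, zero_div]
  · rw [not_lt] at hz
    rw [le_div_iff₀ hs]
    exact mul_le_mul_of_nonneg_left hz (norm_nonneg _)

/-- `0 ≤ θ_{s,R} ≤ 1_{B̄(0,R)}`, hence `∫ |θ_{s,R}(x − y)| g(y) dy`-type bounds: for `0 ≤ s < R`,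
`∫ θ_{s,R} ≤ |B̄(0,R)|` and more generally `∫ |θ_{s,R}(z)| dz ≤ |B̄(0,R)|`. [folklore] -/
theorem integral_abs_radialCutoff_le (hs : 0 ≤ s) (h₁ : s < R) :
    ∫ z, |(radialCutoff s R : EuclideanSpace ℝ (Fin 3) → ℝ) z| ≤
      (volume (closedBall (0 : EuclideanSpace ℝ (Fin 3)) R)).toReal := by
  set θ : EuclideanSpace ℝ (Fin 3) → ℝ := radialCutoff s R with hθ
  have hθs : ContDiff ℝ 1 θ := radialCutoff_contDiff s R
  have hθc : HasCompactSupport θ := hasCompactSupport_radialCutoff hs h₁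
  have h1 : ∫ z, |θ z| ≤
      ∫ z, (closedBall (0 : EuclideanSpace ℝ (Fin 3)) R).indicator (fun _ => (1 : ℝ)) z := by
    refine integral_mono (hθs.continuous.integrable_of_hasCompactSupport hθc).abs
      ((integrable_indicator_iff measurableSet_closedBall).2
        (integrableOn_const (hs := measure_closedBall_lt_top.ne))) fun z => ?_
    by_cases hz : z ∈ closedBall (0 : EuclideanSpace ℝ (Fin 3)) R
    · rw [indicator_of_mem hz, abs_of_nonneg (radialCutoff_nonneg s R z)]
      exact radialCutoff_le_one s R z
    · rw [indicator_of_notMem hz, hθ, radialCutoff_eq_zero hs h₁, abs_zero]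
      rw [mem_closedBall_zero_iff, not_le] at hz
      exact hz.le
  rw [integral_indicator_const _ measurableSet_closedBall, smul_eq_mul, mul_one,
    measureReal_def] at h1
  exact h1

/-- **`∫ ‖Dθ_{s,R}‖ ≤ 3 |B̄(0,R)| / s`** for `0 < s < R`: integrate `‖Dθ(z)‖ ≤ −Dθ(z)z/s` and
use `∫ Dθ(z) z dz = −∫ θ div(id) = −3 ∫ θ ≥ −3|B̄_R|` (one integration by parts on the whole
space, `0 ≤ θ ≤ 1_{B̄_R}`). [folklore] -/
theorem integral_norm_fderiv_radialCutoff_le (hs : 0 < s) (h₁ : s < R) :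
    ∫ z, ‖fderiv ℝ (radialCutoff s R : EuclideanSpace ℝ (Fin 3) → ℝ) z‖ ≤
      3 * (volume (closedBall (0 : EuclideanSpace ℝ (Fin 3)) R)).toReal / s := by
  set θ : EuclideanSpace ℝ (Fin 3) → ℝ := radialCutoff s R with hθ
  have hθs : ContDiff ℝ 1 θ := radialCutoff_contDiff s R
  have hθc : HasCompactSupport θ := hasCompactSupport_radialCutoff hs.le h₁
  -- integration by parts against the identity field
  have hibp := integral_mul_divergence_add_eq_zero_left (u := fun w : EuclideanSpace ℝ (Fin 3) => w)
    hθs contDiff_id hθc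
  have hdiv3 : ∀ z : EuclideanSpace ℝ (Fin 3),
      VectorCalculus.divergence (fun w : EuclideanSpace ℝ (Fin 3) => w) z = 3 := fun z => by
    rw [divergence_eq_traceCLM, show (fun w : EuclideanSpace ℝ (Fin 3) => w) = id from rfl,
      fderiv_id, traceCLM_apply, ContinuousLinearMap.coe_id, LinearMap.trace_id,
      finrank_euclideanSpace_fin]
    norm_num
  have hdiv : (fun z => θ z * VectorCalculus.divergence (fun w : EuclideanSpace ℝ (Fin 3) => w) z) =
      fun z => 3 * θ z := by
    funext z; rw [hdiv3]; ring
  have hinner : (fun z : EuclideanSpace ℝ (Fin 3) => ⟪z, gradient θ z⟫) = fun z => fderiv ℝ θ z z := by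
    funext z; exact inner_gradient_eq_fderiv_apply z z
  rw [hdiv, hinner, integral_const_mul] at hibp
  -- `∫ θ ≤ |B̄_R|`
  have hθle : ∫ z, θ z ≤ (volume (closedBall (0 : EuclideanSpace ℝ (Fin 3)) R)).toReal :=
    (integral_mono (hθs.continuous.integrable_of_hasCompactSupport hθc)
      (hθs.continuous.integrable_of_hasCompactSupport hθc).abs fun z => le_abs_self _).trans
      (integral_abs_radialCutoff_le hs.le h₁)
  -- integrate the pointwise bound
  have hint : Integrable fun z => fderiv ℝ θ z z := by
    refine ((hθs.continuous_fderiv one_ne_zero).clm_apply continuous_id).integrable_of_hasCompactSupport ?_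
    refine (hθc.fderiv (𝕜 := ℝ)).mono' fun z hz => subset_tsupport _ ?_
    rw [mem_support] at hz ⊢
    intro h
    exact hz (by simp [h])
  calc ∫ z, ‖fderiv ℝ θ z‖ ≤ ∫ z, -fderiv ℝ θ z z / s :=
        integral_mono_of_nonneg (Eventually.of_forall fun z => norm_nonneg _)
          ((hint.neg).div_const s) (Eventually.of_forall fun z => norm_fderiv_radialCutoff_le hs h₁ z)
    _ = -(∫ z, fderiv ℝ θ z z) / s := by rw [integral_div, integral_neg]
    _ = 3 * (∫ z, θ z) / s := by rw [show -(∫ z, fderiv ℝ θ z z) = 3 * ∫ z, θ z by linarith]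
    _ ≤ 3 * (volume (closedBall (0 : EuclideanSpace ℝ (Fin 3)) R)).toReal / s := by
        gcongr

end Cutoff

/-! ## Second derivatives of the truncated Newtonian potential -/

section NearHessian

variable {r₀ r₁ : ℝ}

/-- **`∫ Γ₀(z) ∂ₑ∂ₑG(x − z) dz = ∫ D²Γ₀(z)(e,e) (G(x − z) − G(x)) dz`** for `G ∈ C²(ℝ³)` bounded
with bounded gradient (Gilbarg–Trudinger, Lemma 4.2 with (4.10), boundary-free: the tree's
`czDiff_newtonNearHess_eq_newtonNearPotential` for the globally `½`-Hölder density `G`, read in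
the variable `z = x − y`). Both integrals converge absolutely. [cite: GilbargTrudinger2001, Lemma 4.2 with (4.10)] -/
theorem integral_newtonNear_mul_pdd_eq (h₀ : 0 < r₀) (h₁ : r₀ < r₁)
    {G : EuclideanSpace ℝ (Fin 3) → ℝ} (hG : ContDiff ℝ 2 G) {S L : ℝ}
    (hS : ∀ y, ‖G y‖ ≤ S) (hL : ∀ y, ‖fderiv ℝ G y‖ ≤ L) (x e : EuclideanSpace ℝ (Fin 3)) :
    ∫ z, newtonNear r₀ r₁ z * fderiv ℝ (fun y => fderiv ℝ G y e) (x - z) e =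
      ∫ z, fderiv ℝ (fderiv ℝ (newtonNear r₀ r₁)) z e e * (G (x - z) - G x) := by
  -- `G` is Lipschitz and bounded, hence `½`-Hölder
  have hL0 : 0 ≤ L := (norm_nonneg _).trans (hL 0)
  have hLip : LipschitzWith (Real.toNNReal L) G :=
    lipschitzWith_of_nnnorm_fderiv_le (hG.differentiable two_ne_zero) fun y => by
      rw [← NNReal.coe_le_coe, coe_nnnorm, Real.coe_toNNReal _ hL0]
      exact hL y
  have hH := holderWith_of_lipschitzWith_of_norm_le (r := (1 / 2 : ℝ≥0))
    (by rw [← NNReal.coe_le_coe]; norm_num) hLip hS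
  have key := czDiff_newtonNearHess_eq_newtonNearPotential h₀ h₁ hG hH (by norm_num)
    (by rw [← NNReal.coe_lt_coe]; norm_num) e e x
  rw [newtonNearPotential_apply] at key
  rw [← key, czDiff]
  -- change variables `y = x - z`
  rw [← integral_sub_left_eq_self (fun y => newtonNearHess r₀ r₁ e e (x - y) • (G y - G x)) volume x]
  refine integral_congr_ae (Eventually.of_forall fun z => ?_)
  simp only [sub_sub_cancel, smul_eq_mul, newtonNearHess]

/-- Integrability of the difference integrand `z ↦ D²Γ₀(z)(e,e) (G(x − z) − G(x))` for a
Lipschitz bounded density (`|D²Γ₀(z)| ≲ |z|⁻³`, `|G(x−z) − G(x)| ≲ min(|z|, 1)`; the tree's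
`IsHolderCZKernel.integrable_czDiff`). [folklore] -/
theorem integrable_hess_newtonNear_mul_sub (h₀ : 0 < r₀) (h₁ : r₀ < r₁)
    {G : EuclideanSpace ℝ (Fin 3) → ℝ} (hG : ContDiff ℝ 1 G) {S L : ℝ}
    (hS : ∀ y, ‖G y‖ ≤ S) (hL : ∀ y, ‖fderiv ℝ G y‖ ≤ L) (x e : EuclideanSpace ℝ (Fin 3)) :
    Integrable fun z => fderiv ℝ (fderiv ℝ (newtonNear r₀ r₁)) z e e * (G (x - z) - G x) := by
  have hL0 : 0 ≤ L := (norm_nonneg _).trans (hL 0)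
  have hLip : LipschitzWith (Real.toNNReal L) G :=
    lipschitzWith_of_nnnorm_fderiv_le (hG.differentiable one_ne_zero) fun y => by
      rw [← NNReal.coe_le_coe, coe_nnnorm, Real.coe_toNNReal _ hL0]
      exact hL y
  have hH := holderWith_of_lipschitzWith_of_norm_le (r := (1 / 2 : ℝ≥0))
    (by rw [← NNReal.coe_le_coe]; norm_num) hLip hS
  obtain ⟨A, B, A₀, -, -, -, hK⟩ := exists_isHolderCZKernel_newtonNearHess h₀ h₁
  have hI := (hK e e).integrable_czDiff hH (by norm_num) (by rw [← NNReal.coe_lt_coe]; norm_num) x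
  have hI' := hI.comp_sub_left x
  refine hI'.congr (Eventually.of_forall fun z => ?_)
  simp only [sub_sub_cancel, smul_eq_mul, newtonNearHess]

end NearHessian

/-! ## Registered sub-goal of the stub -/

/-- **Registered sub-goal** (file I of stub `stub_payerTomography`): the boundary-free bound for
the gradient of the radial cutoffs, `∫ ‖Dθ_{s,R}‖ ≤ 3|B̄(0,R)|/s` (`0 < s < R`), the input that
replaces the sphere `|z| = R` in the far-shell integration by parts. [folklore] -/
theorem payerTomography_cutoffGradient_bound : ∀ (s R : ℝ), 0 < s → s < R → ∫ z, ‖fderiv ℝ (radialCutoff s R : EuclideanSpace ℝ (Fin 3) → ℝ) z‖ ≤ 3 * (volume (Metric.closedBall (0 : EuclideanSpace ℝ (Fin 3)) R)).toReal / s :=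
  fun _ _ hs h => integral_norm_fderiv_radialCutoff_le hs h

end Summit.NavierStokesRegularity.NavierStokesRegularity.Theorems

end
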